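import Summits.BirchSwinnertonDyer.BirchSwinnertonDyer.Theorems.SchneiderFreeAdditiveX3AnticycControlAdditiveTorsionExponents
import Summits.BirchSwinnertonDyer.BirchSwinnertonDyer.Theorems.SchneiderFreeAdditiveX3AnticycControlAdditiveLocalKernelAtP
import Summits.BirchSwinnertonDyer.BirchSwinnertonDyer.Theorems.SchneiderFreeAdditiveX3AnticycControlAdditiveBaseCountTorsionExact
import Summits.BirchSwinnertonDyer.BirchSwinnertonDyer.Theorems.SchneiderFreeAdditiveX3AnticycControlAdditiveSurgeryNoLocal
import Summits.BirchSwinnertonDyer.Rank1Residual.X11b.RouteR1LocSurj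
import Summits.BirchSwinnertonDyer.Rank1Residual.X11b.RouteR1Coinvariants
import Summits.BirchSwinnertonDyer.Rank1Residual.X11b.WeakLeopoldt
import Summits.BirchSwinnertonDyer.Rank1Residual.X11b.BDPRouteLocalKernelExact
import Literature.NumberTheory.GaloisRepresentations.NumberFieldCdTwo
import Literature.NumberTheory.EllipticCurves.AnticyclotomicPrimeDecomposition
import Summits.BirchSwinnertonDyer.BirchSwinnertonDyer.Theorems.SchneiderFreeAdditiveX3AnticycControlAdditiveStubNoLocalPTorsionOfAtoms
import HarnessLib

/-!
# Crux `AnticycControlAdditive` (route `SchneiderFreeAdditiveX3`, items stmt-BirchSwinnertonDyer-19178 /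
# 19295): the `t_p ≥ 1` half, regime B1 — T-B6-2′ from the cited facts, Fin_v and non-splitting

Seat `bsd-schneider-door-c4`, gen 2 (cell `bsd-schneider-ideate`). On the `t_p ≥ 1` frames of the crux
(`E(ℚ_p)[p] ≠ 0`: the `(3, e = 2)` pairs with local `3`-torsion, 57.9 % of B6's optimal curves) with
`E(K)[p] = 0` (regime B1; every isogeny class of the cells has such a member, kit j248537), gen 0's
torsion-robust glue `additiveControlOnTreeAt_of_torsAtoms` (p420051) carried six atoms on constructed
objects. This file discharges ALL of them modulo the cited facts and exactly TWO class-field-theoretic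
inputs about the anticyclotomic tower above `p`, carried as explicit hypotheses:
Fin_v (`SchneiderFreeControlAtoms.LocalTowerTorsionFiniteAt (E_K) p κ 𝔭`: `E(K_{∞,w})[p^∞]` finite) and
non-splitting (`¬ D_𝔭 ≤ ker κ`: `𝔭` does not split completely in `K_∞`).

* `exists_global_of_locFamily_noLocal` — the element-form Poitou–Tate surjectivity on `{𝔭} ∪ Σ(N⁺)`
  (gen 0's input `hloc`) from `levelLiftingP_of_finite_noLocal` (companion `…SurgeryNoLocal.lean`),
  transported along `inflToCompletion` / `topEquivH1` as in route R1's `locSurjAt_of_levelLifting`;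
* **`additiveControlOnTreeAt_of_facts_of_localTowerTorsionFinite`** — T-B6-2′
  (`SchneiderFree.AdditiveControlOnTreeAt`, the anticyclotomic control EQUALITY at an additive prime) at a
  regime-B1 frame from: `g = 0` (`natCard_ker_resOfLe_top_eq_natCard_fixedPoints`, gen 0), `t = t_p`
  (`natCard_localKer_eq_pow_of_finite`, `…LocalKernelAtP.lean`), (P6-add-tors)
  (`additiveBaseSelmerCountTors_of_rankOne`, `…BaseCountTorsionExact.lean`), (P9⁺) (above), (L10)
  (`coinvariantsTrivialAt_of_subsingleton_noLocal` + weak Leopoldt), (P11) (Brink ∘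
  `localKernelOrderAt_of_not_le`).

With `…NoLocalPTorsionOfFacts.lean` (the `t_p = 0` half) the crux is now: CLOSED MODULO the cited facts
{`kolyvagin`, `poitouTate_selmerStructure_duality`, `poitouTate_sha_tateDual`,
`localEulerPoincareCharacteristic`, `fieldCdLE_two_of_numberField`, Brink} on every frame with
`E(ℚ_p)[p] = 0`; CLOSED MODULO the same facts + Fin_v + non-splitting on every frame with `E(K)[p] = 0`;
OPEN on regime B2 (`E(K)[p] ≠ 0`: `p = 3`, the `3`-torsion members of 64.4 % of the `p = 3` X3 classes —
Keller–Yin 2402.12781 App. B Thm. B.0.6's count, or the isogeny transport of memo CONTROL-tp §3bis).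
CONDITIONAL; no `Prop` fact minted; closes nothing by itself; BSD is not proved by any of this.

References: [JetchevSkinnerWan2017] §3.2–3.3 (arXiv:1512.06894 pp. 10–14); [Castella2018] Thm. 2.3;
[GreenbergLNM1716] §3 Lemma 3.3; [MilneADT2006] I 2.8, 4.10; [Brink2007] Thm. 2, Cor. 1.
-/

noncomputable section

open scoped Classical

open CategoryTheory Field NumberField IsDedekindDomain WeierstrassCurve
open Literature.NumberTheory.EllipticCurves Literature.NumberTheory.EllipticCurves.GreenbergSelmer
open Literature.NumberTheory.GaloisRepresentations
open Literature.NumberTheory.GaloisRepresentations.DiscreteGaloisModule (SelmerStructure TateDual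
  tateDual localTatePairingZMod unramifiedSubgroup)
open Literature.NumberTheory.GaloisCohomology
open scoped ContRepresentation
open Literature.NumberTheory.EllipticCurves.ModularForms
  Literature.NumberTheory.EllipticCurves.Rank1Residual
  Literature.NumberTheory.EllipticCurves.Rank1Residual.Typed
  Summit.BirchSwinnertonDyer.Rank1Residual
  Summit.BirchSwinnertonDyer.Rank1Residual.X11b
  Summit.BirchSwinnertonDyer.Rank1Residual.X11b.AcSelmer
  Summit.BirchSwinnertonDyer.Rank1Residual.X11b.LocBridge
  Summit.BirchSwinnertonDyer.BirchSwinnertonDyer.Theorems.SchneiderFree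
  Summit.BirchSwinnertonDyer.BirchSwinnertonDyer.Theorems.SchneiderFreeControlAtoms

set_option linter.dupNamespace false

namespace Summit.BirchSwinnertonDyer.BirchSwinnertonDyer.Theorems.SchneiderFreeAdditiveX3

open Summit.BirchSwinnertonDyer.Rank1Residual.X11b.Levels

section LocFamily

open WeierstrassCurve

variable {W : WeierstrassCurve ℚ} [W.IsElliptic] {K : Type} [Field K] [NumberField K] {p : ℕ}
  [Fact p.Prime]

/-- **The element-form Poitou–Tate surjectivity on `T = {𝔭} ∪ Σ(N⁺)` WITHOUT (iv)** — the input
`hloc` of gen 0's torsion-robust count `natCard_endInvariants_mul_natCard_resKer_eq_nPlus`: for `E/ℚ`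
over an imaginary quadratic `K`, `E(K)[p] = 0` (global no-invariants), primes `𝔭 ≠ 𝔮` above `p` and
`Sel_𝔮(K, E[p^∞])` finite, EVERY family of local classes `x_v ∈ H¹(K_v, E[p^∞])`, `v ∈ {𝔭} ∪ Σ(N⁺)`
(decomposition-group form), is the localisation of a global class of `H¹(K, E[p^∞])` that is locally
trivial at every other finite place away from `p` (`levelLiftingP_of_finite_noLocal` transported along
`inflToCompletion` / `topEquivH1`, as in route R1's `locSurjAt_of_levelLifting`). CONDITIONAL on the
cited Poitou–Tate fact and Milne I 2.8 (hypotheses).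
[cite: JetchevSkinnerWan2017, Prop. 3.3.2 (arXiv:1512.06894 p. 11)] [cite: MilneADT2006, Ch. I, Thm. 4.10(b) and Thm. 2.8] -/
theorem exists_global_of_locFamily_noLocal (hK : IsImaginaryQuadratic K)
    (hPT : poitouTate_selmerStructure_duality K)
    (hEP : ∀ v : HeightOneSpectrum (𝓞 K), localEulerPoincareCharacteristic (v.adicCompletion K))
    (hΓ : ∀ Q : (W.baseChange K).geomPrimaryTorsion p,
      (∀ σ : absoluteGaloisGroup K, primaryGaloisModule (W.baseChange K) p σ Q = Q) → Q = 0)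
    {𝔭 𝔮 : HeightOneSpectrum (𝓞 K)} (h𝔭 : ((p : ℕ) : 𝓞 K) ∈ 𝔭.asIdeal)
    (h𝔮 : ((p : ℕ) : 𝓞 K) ∈ 𝔮.asIdeal) (hne : 𝔮 ≠ 𝔭)
    (hfin : Finite (selmerAcBase (W.baseChange K) p 𝔮 ∅))
    (x : Π v : ↥(insert 𝔭 (nPlusPlaces_finite (W := W) (p := p) (K := K) hK.1).toFinset),
      subgroupH1 ((⊤ : Subgroup (absoluteGaloisGroup K)) ⊓ decomp (v : HeightOneSpectrum (𝓞 K)))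
        ((W.baseChange K).geomPrimaryTorsion p)) :
    ∃ c : (W.baseChange K).subgroupH1 p (⊤ : Subgroup (absoluteGaloisGroup K)),
      locAtFinset (W.baseChange K) p _ c = x ∧
      ∀ v : HeightOneSpectrum (𝓞 K), ((p : ℕ) : 𝓞 K) ∉ v.asIdeal → v ∉ (∅ : Set _) →
        v ∉ insert 𝔭 (nPlusPlaces_finite (W := W) (p := p) (K := K) hK.1).toFinset →
          c ∈ awayKer ⊤ ((W.baseChange K).geomPrimaryTorsion p) v := by
  haveI : IsTotallyComplex K := hK.2
  haveI := hfin
  haveI hEK : (W.baseChange K).IsElliptic := by rw [baseChange]; infer_instance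
  have hM := isOpen_stabilizer_geomPrimaryTorsion (W.baseChange K) p
  have hS : (nPlusPlaces W K p).Finite := nPlusPlaces_finite (W := W) (p := p) (K := K) hK.1
  -- the family in completion form
  have hmemF : ∀ v : (insert 𝔭 (nPlusPlaces W K p) : Set (HeightOneSpectrum (𝓞 K))),
      (v : HeightOneSpectrum (𝓞 K)) ∈ insert 𝔭 hS.toFinset := fun v ↦
    Finset.mem_insert.mpr ((Set.mem_insert_iff.mp v.2).imp id hS.mem_toFinset.mpr)
  let τ : ∀ v : (insert 𝔭 (nPlusPlaces W K p) : Set (HeightOneSpectrum (𝓞 K))),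
      galoisCohomology ((primaryGaloisModule (W.baseChange K) p).toLocal
        (Sum.inr (v : HeightOneSpectrum (𝓞 K)))) 1 :=
    fun v ↦ inflToCompletion hM (v : HeightOneSpectrum (𝓞 K)) (x ⟨v, hmemF v⟩)
  obtain ⟨K₀, hK₀⟩ := exists_pow_nsmul_family_eq_zero (hS.insert 𝔭) τ
  -- finiteness of the relaxed conjugate group on `R = {v ∈ T : v ∤ p}`
  have hfin0 : Finite (acStructure (primaryGaloisModule (W.baseChange K) p) p 𝔮
      (∅ : Set (HeightOneSpectrum (𝓞 K)))).selmerGroup := by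
    refine Nat.finite_of_card_ne_zero ?_
    rw [← natCard_selmerAcBase_eq_natCard_selmerGroup (W.baseChange K) p 𝔮 ∅]
    exact Nat.card_pos.ne'
  have hfinR : Finite (acStructure (primaryGaloisModule (W.baseChange K) p) p 𝔮
      {v | (Sum.inr v : Place K) ∈ exceptionalPlaces W K p hK.1 ∧
        ((p : ℕ) : 𝓞 K) ∉ v.asIdeal}).selmerGroup :=
    finite_selmerGroup_acStructure_of_finite_empty _ p 𝔮 _ (finite_relaxationSet hK.1) hfin0
      fun v hv _ ↦ finite_galoisCohomology_one_primary_toLocal (W.baseChange K) p v (hEP v) hv.2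
  -- Poitou–Tate surgery without (iv)
  obtain ⟨N, xN, hxN, hloc⟩ := levelLiftingP_of_finite_noLocal (W.baseChange K) p 𝔭
    (nPlusPlaces W K p) (exceptionalPlaces W K p hK.1) hPT (fun w ↦ IsTotallyComplex.isComplex w)
    hΓ h𝔭 h𝔮 hne (fun v hv ↦ hv.1) (inl_mem_exceptionalPlaces hK.1)
    (fun v hv ↦ inr_mem_exceptionalPlaces_of_mem hK.1 hv)
    (fun v hv ↦ inr_mem_exceptionalPlaces_of_mem_nPlusPlaces hK.1 hv)
    (fun v hv ↦ inr_mem_exceptionalPlaces_of_not_hasGoodReductionAt hK.1 hv) hfinR K₀ τ hK₀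
  refine ⟨topEquivH1 hM (galoisCohomology.map (primaryInclusion (W.baseChange K) p N) 1 xN), ?_, ?_⟩
  · funext v
    have hvS : (v : HeightOneSpectrum (𝓞 K)) ∈
        (insert 𝔭 (nPlusPlaces W K p) : Set (HeightOneSpectrum (𝓞 K))) :=
      Set.mem_insert_iff.mpr ((Finset.mem_insert.mp v.2).imp id hS.mem_toFinset.mp)
    apply inflToCompletion_injective hM (v : HeightOneSpectrum (𝓞 K))
    rw [locAtFinset_apply, inflToCompletion_resOfLe_topEquivH1]
    exact hloc ⟨v, hvS⟩
  · intro v hpv _ hvT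
    have hvS : v ∉ nPlusPlaces W K p := fun h ↦
      hvT (Finset.mem_insert_of_mem (hS.mem_toFinset.mpr h))
    rw [awayKer, AddMonoidHom.mem_ker]
    apply inflToCompletion_injective hM v
    rw [inflToCompletion_resOfLe_topEquivH1, map_zero]
    exact localization_map_primaryInclusion_eq_zero_of_mem_upperStructureP (W.baseChange K) p N 𝔭
      (nPlusPlaces W K p) hxN h𝔭 hpv hvS

end LocFamily

/-! ## Regime B1 assembly: T-B6-2′ at a `t_p ≥ 1` frame from the cited facts, Fin_v, non-splitting, `E(K)[p] = 0` -/

section RegimeB1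

open WeierstrassCurve

variable {W : WeierstrassCurve ℚ} [W.IsElliptic] [W.IsGloballyMinimal] {K : Type} [Field K]
  [NumberField K] {p : ℕ} [Fact p.Prime] {κ : ZpExtension K p}

/-- **T-B6-2′ (`SchneiderFree.AdditiveControlOnTreeAt`) on the `t_p ≥ 1` half, regime B1, from the cited
facts and the two remaining typed inputs Fin_v and non-splitting.** For `K` imaginary quadratic with the
additive `p` split, `κ` anticyclotomic with topological generator `γ`, a degree-one `𝔭 ∋ p` that does NOT
split completely in `K_∞` (`¬ D_𝔭 ≤ ker κ`) and at which Fin_v holds (`LocalTowerTorsionFiniteAt`: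
`E(K_{∞,w})[p^∞]` finite), `E(K)[p] = 0` (regime B1), `rank E(K) = 1`, `Ш(E/K)` finite, `P` non-torsion:
the anticyclotomic control EQUALITY holds. Gen 0's torsion-robust glue `additiveControlOnTreeAt_of_torsAtoms`
with ALL its atoms discharged: `g = 0` (`natCard_ker_resOfLe_top_eq_natCard_fixedPoints` + no global
invariants), `t = t_p` (`natCard_localKer_eq_pow_of_finite`), (P6-add-tors) (`additiveBaseSelmerCountTors_of_rankOne`),
(P9⁺) (`exists_global_of_locFamily_noLocal`), (L10) (`coinvariantsTrivialAt_of_subsingleton_noLocal` + weak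
Leopoldt), (P11) (Brink ∘ `localKernelOrderAt_of_not_le`). CONDITIONAL on the five cited facts; Fin_v and
non-splitting are explicit hypotheses (class field theory for the anticyclotomic tower above `p`, not in
the tree); closes nothing by itself; BSD is not proved by any of this.
[cite: JetchevSkinnerWan2017, Thm. 3.3.1 (arXiv:1512.06894 p. 11)] [cite: Castella2018, Thm. 2.3 (arXiv:1704.06608 p. 5)]
[cite: MilneADT2006, Ch. I, Thm. 4.10 and Thm. 2.8] [cite: Brink2007, Thm. 2 and Cor. 1] -/
theorem additiveControlOnTreeAt_of_facts_of_localTowerTorsionFinite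
    (hPT : poitouTate_selmerStructure_duality K) (hPT2 : poitouTate_sha_tateDual K)
    (hEP : ∀ v : HeightOneSpectrum (𝓞 K), localEulerPoincareCharacteristic (v.adicCompletion K))
    (hcd : fieldCdLE_two_of_numberField)
    (hBr : ZpExtension.decomp_not_le_kerSubgroup_of_isAnticyclotomic K p)
    (hp2 : p ≠ 2) (hadd : Addv W p) (hK : IsImaginaryQuadratic K) (hsplit : SplitsIn K p)
    (hκ : κ.IsAnticyclotomic) (γ : absoluteGaloisGroup K) [hγ : Fact (κ.IsTopGenerator γ)]
    (𝔭 : HeightOneSpectrum (𝓞 K)) (h𝔭 : ((p : ℕ) : 𝓞 K) ∈ 𝔭.asIdeal)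
    (he : 𝔭.asIdeal.ramificationIdx (𝓞 ℚ) = 1) (hf : 𝔭.asIdeal.inertiaDeg (𝓞 ℚ) = 1)
    (hivK : ∀ x : (W.baseChange K).toAffine.Point, p • x = 0 → x = 0)
    (hFin : LocalTowerTorsionFiniteAt (W.baseChange K) p κ 𝔭) (hv : ¬ decomp 𝔭 ≤ κ.kerSubgroup)
    (hrank : (W.baseChange K).mordellWeilRank = 1) (hSha : (W.baseChange K).ShaFinite)
    (P : (W.baseChange K).toAffine.Point) (hPinf : ¬ IsOfFinAddOrder P) :
    AdditiveControlOnTreeAt p κ 𝔭 γ (embAt K p 𝔭 h𝔭 he hf) P := by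
  have hp : p.Prime := Fact.out
  haveI : IsTotallyComplex K := hK.2
  haveI hEK : (W.baseChange K).IsElliptic := by rw [baseChange]; infer_instance
  have hpN : p ∣ W.conductorNorm ℤ := (W.dvd_conductorNorm_iff_not_hasGoodReductionAtPrime p).mpr hadd.1
  have hΓ : ∀ Q : (W.baseChange K).geomPrimaryTorsion p,
      (∀ σ : absoluteGaloisGroup K, primaryGaloisModule (W.baseChange K) p σ Q = Q) → Q = 0 :=
    Summit.BirchSwinnertonDyer.Rank1Residual.X11b.SelmerCount.noInvariants_of_forall_torsion_eq_zero
      (W.baseChange K) p hivK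
  -- (P6-add-tors) at `𝔭`; finiteness of Castella's group at the conjugate `𝔮`
  obtain ⟨hfin𝔭, a6, hcard6, ha6⟩ := additiveBaseSelmerCountTors_of_rankOne W p K hPT hEP hadd hK
    hsplit hivK hrank hSha P hPinf 𝔭 h𝔭 he hf
  obtain ⟨σ, 𝔮, -, hne, h𝔮, -⟩ :=
    LocalIndexTransport.exists_conj_prime_of_splitsIn K p hK.1 hsplit h𝔭
  obtain ⟨he', hf'⟩ := degreeOne_of_splitsIn hK.1 hsplit h𝔮
  obtain ⟨hfin𝔮, -⟩ := additiveBaseSelmerCountTors_of_rankOne W p K hPT hEP hadd hK hsplit hivK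
    hrank hSha P hPinf 𝔮 h𝔮 he' hf'
  -- `t = t_p`
  obtain ⟨t, ht⟩ := exists_natCard_primaryComponent_padic_eq_pow W p
  have h𝔭ker := natCard_localKer_eq_pow_of_finite W p κ 𝔭 h𝔭 he hf hFin hv ht
  -- `g = 0`
  haveI : Finite (FixedPoints.addSubgroup κ.kerSubgroup ((W.baseChange K).geomPrimaryTorsion p)) := by
    haveI := hFin.to_subtype
    refine Finite.of_injective (fun b ↦ (⟨(b : (W.baseChange K).geomPrimaryTorsion p),
      (FixedPoints.mem_addSubgroup _ _ _).mpr fun x ↦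
        b.2 ⟨x.1, (Subgroup.mem_inf.mp x.2).2⟩⟩ :
      FixedPoints.addSubgroup ↥(decomp 𝔭 ⊓ κ.kerSubgroup) ((W.baseChange K).geomPrimaryTorsion p)))
      fun a b hab ↦ ?_
    apply Subtype.ext
    exact congrArg (fun z : FixedPoints.addSubgroup ↥(decomp 𝔭 ⊓ κ.kerSubgroup)
      ((W.baseChange K).geomPrimaryTorsion p) ↦ (z : (W.baseChange K).geomPrimaryTorsion p)) hab
  have hres : Nat.card ((W.baseChange K).resOfLe p (le_top : κ.kerSubgroup ≤ ⊤)).ker = p ^ 0 := by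
    rw [natCard_ker_resOfLe_top_eq_natCard_fixedPoints (W.baseChange K) p κ, pow_zero]
    haveI : Unique {m : (W.baseChange K).geomPrimaryTorsion p |
        ∀ σ : absoluteGaloisGroup K, σ • m = m} :=
      { default := ⟨0, fun σ ↦ smul_zero σ⟩
        uniq := fun a ↦ Subtype.ext (hΓ a.1 a.2) }
    exact Nat.card_unique
  -- `a = a6 − t`
  have hcard6' : Nat.card (selmerAcBase (W.baseChange K) p 𝔭 ∅) * p ^ t = p ^ a6 := by
    rw [← ht]; exact hcard6
  have hle : t ≤ a6 :=
    (Nat.pow_dvd_pow_iff_le_right hp.one_lt).mp ⟨_, by rw [mul_comm]; exact hcard6'.symm⟩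
  have hcardSel : Nat.card (selmerAcBase (W.baseChange K) p 𝔭 ∅) = p ^ (a6 - t) := by
    have hsplitpow : p ^ a6 = p ^ (a6 - t) * p ^ t := by rw [← pow_add, Nat.sub_add_cancel hle]
    rw [hsplitpow] at hcard6'
    exact Nat.eq_of_mul_eq_mul_right (pow_pos hp.pos t) hcard6'
  -- weak Leopoldt `H²(K, E[p^∞]) = 0`
  have htor := exists_pow_nsmul_local_eq_zero W p hK.1 hsplit
  haveI := hfin𝔭
  have h2 := WeakLeopoldt.subsingleton_galoisCohomology_two_primary (W.baseChange K) p 𝔭 ∅ hPT2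
    (fieldCdLE_two_of_isTotallyComplex hcd K p) hΓ htor
  -- gen 0's torsion-robust glue with every atom discharged
  refine additiveControlOnTreeAt_of_torsAtoms (W := W) hK hsplit hpN hκ γ 𝔭 h𝔭 (embAt K p 𝔭 h𝔭 he hf)
    P 0 t (a6 - t) hres h𝔭ker ⟨⟨hfin𝔭, hcardSel⟩, ?_⟩
    (fun x _ ↦ exists_global_of_locFamily_noLocal hK hPT hEP hΓ h𝔭 h𝔮 hne hfin𝔮 x)
    (coinvariantsTrivialAt_of_subsingleton_noLocal (W.baseChange K) p κ hPT hEP h𝔭 h𝔮 hne hΓ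
      hfin𝔮 h2 hγ.out)
    (fun v hv' ↦ by
      obtain ⟨hpv, -, he1, hf1⟩ := (mem_nPlusPlaces_iff v).mp hv'
      exact localKernelOrderAt_of_not_le (W.baseChange K) κ hpv (hBr hK hp2 κ hκ v hpv he1 hf1))
  rw [Nat.cast_sub hle, ha6]
  push_cast
  ring

end RegimeB1


/-! ## Class level: every frame with `E(K)[p] = 0` (regimes A ∪ B1), modulo facts + the two CFT claims -/

section ClassLevelB

open Summit.BirchSwinnertonDyer.BirchSwinnertonDyer.Theses.SchneiderFreeAdditiveX3

/-- **The control crux on every B6 datum / anticyclotomic frame with `E(K)[p] = 0` (regimes A ∪ B1 —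
every frame except the `3`-torsion members of regime B2), from the cited facts and the two typed
class-field-theoretic inputs about the anticyclotomic tower above `p`** — Fin_v in its class form
`SchneiderFreeControlAtoms.LocalTowerTorsionFiniteClaim` (the tree's typed predicate; NOT in print at an
additive prime) and non-splitting of the primes above `p` in `K_∞^{ac}`, the CITED fact
`ZpExtension.decomp_not_le_kerSubgroup_above_of_isAnticyclotomic` (Brink 2007 Cor. 1: "No rational
prime splits completely in `K_anti`" — "the prime `l` is (infinitely) ramified in `K_anti`"), PLUS
Kolyvagin's theorem and the five cited cohomological / decomposition facts. The pointwise engine is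
`additiveControlOnTreeAt_of_facts_of_localTowerTorsionFinite`. CONDITIONAL; the extra binder
`∀ x : E(K), p • x = 0 → x = 0` marks exactly what regime B2 still lacks; closes nothing by itself; BSD is
not proved by any of this. [cite: JetchevSkinnerWan2017, Thm. 3.3.1 (arXiv:1512.06894 p. 11)]
[cite: Kolyvagin1990, Thm. A] [cite: MilneADT2006, Ch. I, Thm. 4.10 and Thm. 2.8] [cite: Brink2007, Thm. 2 and Cor. 1] -/
theorem anticycControlAdditive_noGlobalPTorsion_of_facts_of_claims
    (hKo : ∀ (N : ℕ) [NeZero N] (W : WeierstrassCurve ℚ) (K : Type) [Field K] [NumberField K],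
      kolyvagin N W K)
    (hPT : ∀ (K : Type) [Field K] [NumberField K], poitouTate_selmerStructure_duality K)
    (hPT2 : ∀ (K : Type) [Field K] [NumberField K], poitouTate_sha_tateDual K)
    (hEP : ∀ (K : Type) [Field K] [NumberField K] (v : HeightOneSpectrum (𝓞 K)),
      localEulerPoincareCharacteristic (v.adicCompletion K))
    (hcd : fieldCdLE_two_of_numberField)
    (hBr : ∀ (K : Type) [Field K] [NumberField K] (p : ℕ) [Fact p.Prime],
      ZpExtension.decomp_not_le_kerSubgroup_of_isAnticyclotomic K p)
    (hFinV : ∀ (W : WeierstrassCurve ℚ) [W.IsElliptic] [W.IsGloballyMinimal] (p : ℕ) [Fact p.Prime],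
      LocalTowerTorsionFiniteClaim W p)
    (hBr2 : ∀ (K : Type) [Field K] [NumberField K] (p : ℕ) [Fact p.Prime],
      ZpExtension.decomp_not_le_kerSubgroup_above_of_isAnticyclotomic K p) :
    ∀ (W : WeierstrassCurve ℚ) [W.IsElliptic] [W.IsGloballyMinimal] (p : ℕ) [Fact p.Prime],
      W.analyticRank = 1 → p ≠ 2 → ClassX3 W p → Additive.SubSemistableTwist W p →
      ∀ (N : ℕ) [NeZero N] (K : Type) [Field K] [NumberField K]
        (Dt : ModularParametrizationData W N) (H : HeegnerDatum N (NumberField.discr K)) (ι : K →+* ℂ)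
        (P : (W.baseChange K).toAffine.Point),
        W.analyticRank = 1 → Additive.N10.Locus W p → W.conductorNorm ℤ = N → IsImaginaryQuadratic K →
        Odd (NumberField.discr K) → ¬ p ∣ Units.torsionOrder K → SatisfiesHeegnerHypothesis N K →
        (W.quadraticTwist (NumberField.discr K : ℚ)).entireLFunction 1 ≠ 0 →
        WeierstrassCurve.Affine.Point.map ι.toRatAlgHom P = heegnerPointComplex Dt H →
        ¬ IsOfFinAddOrder P →
        (∀ x : (W.baseChange K).toAffine.Point, p • x = 0 → x = 0) →
        ∀ (κ : ZpExtension K p), κ.IsAnticyclotomic →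
          ∀ (γ : Field.absoluteGaloisGroup K) [Fact (κ.IsTopGenerator γ)]
            (𝔭 : HeightOneSpectrum (𝓞 K)) (h𝔭 : ((p : ℕ) : 𝓞 K) ∈ 𝔭.asIdeal)
            (he : 𝔭.asIdeal.ramificationIdx (𝓞 ℚ) = 1) (hf : 𝔭.asIdeal.inertiaDeg (𝓞 ℚ) = 1),
            AdditiveControlOnTreeAt p κ 𝔭 γ (embAt K p 𝔭 h𝔭 he hf) P := by
  intro W _ _ p _ hr hp2 hX hS N _ K _ _ Dt H ι P hr' hloc hN hK hodd hunit hHe hL1 hP hnt hivK κ hκ γ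
    _ 𝔭 h𝔭 he hf
  have hpN : p ∣ W.conductorNorm ℤ := dvd_conductorNorm_of_n10Locus hloc
  have hsplit : SplitsIn K p := splitsIn_of_satisfiesHeegnerHypothesis hN hHe hpN
  obtain ⟨hrank, hSha⟩ := hKo N W K hK hHe ⟨Dt, H, ι, hP⟩ hnt
  exact additiveControlOnTreeAt_of_facts_of_localTowerTorsionFinite (hPT K) (hPT2 K) (hEP K) hcd
    (hBr K p) hp2 hloc.2.1 hK hsplit hκ γ 𝔭 h𝔭 he hf hivK (hFinV W p K hK hsplit κ hκ 𝔭 h𝔭)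
    (hBr2 K p hK hp2 κ hκ 𝔭 h𝔭) hrank hSha P hnt

end ClassLevelB

end Summit.BirchSwinnertonDyer.BirchSwinnertonDyer.Theorems.SchneiderFreeAdditiveX3

end
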